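import Literature.NumberTheory.Transcendental.AyoubRelativeAlgebraicity
import Literature.NumberTheory.Transcendental.AyoubRelativeProofs

/-!
# Ayoub's relative Kontsevich–Zagier theorem revisited — Théorème 1.7 `⇒` for series involving finitely many monomials

Theorems only (no new definitions), on top of
`Literature/NumberTheory/Transcendental/AyoubRelative.lean` (definitions, NAMED FACT
`Literature.NumberTheory.Transcendental.AyoubRel.ayoub_relativeKZ_revisited` = Théorème 1.7 of J. Ayoub, *La version relative de la
conjecture des périodes de Kontsevich–Zagier revisitée*, Tohoku Math. J. (2) 71 (2019) 465–485),
`…/AyoubRelativeProofs.lean` (the polynomial level `ker ∫ ≤ span (relations)` and the case of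
`ϖ`-Laurent POLYNOMIALS) and `…/AyoubRelativeAlgebraicity.lean` (`𝒪†_alg` is a `k`-subalgebra,
derivations preserve it).

## What is proved here

Write `𝒪 = k[z, t, t⁻¹]`, `𝒪((ϖ))` for Laurent series in `ϖ` with coefficients in `𝒪`, `𝒪†_alg` for
the algebraic ones (Notation 1.6), `∫ : 𝒪((ϖ)) → k((ϖ))` for term-by-term integration (the map (5))
and `gens` for Ayoub's generators (a) `∂G/∂zᵢ - G|_{zᵢ=1} + G|_{zᵢ=0}`, (b) `tⱼ ∂H/∂tⱼ`
(`G, H ∈ 𝒪†_alg`). Théorème 1.7 says `ker ∫ ∩ 𝒪†_alg = span_k gens`; `⊇` is proved in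
`AyoubRelative.lean`, `⊆` is the deep (motivic) content and is the named fact.

**Main result** (`mem_span_ayoubGenerators_of_mem_supported`,
`ayoub_relativeKZ_revisited_finiteRank`): the inclusion `⊆` HOLDS, for every field `k` of
characteristic `0`, on the subalgebra of those `F ∈ 𝒪†_alg` which involve only FINITELY MANY
MONOMIALS `z^a t^b`, i.e. `F = ∑_{μ ∈ S} A_μ(ϖ) · z^{a_μ} t^{b_μ}` with `S` finite and
`A_μ ∈ k((ϖ))` — equivalently (`mem_span_ayoubGenerators_of_finiteDimensional`), whose
`ϖ`-coefficients span a finite-dimensional `k`-subspace of `𝒪`. This strictly contains the case of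
`ϖ`-Laurent polynomials of `AyoubRelativeProofs.lean` (`exists_supported_of_finite_support`), e.g.
`F = a(ϖ) · g` with `a ∈ k((ϖ))` algebraic over `k(ϖ)` of infinite support and `g ∈ 𝒪`.

So the content of Théorème 1.7 beyond elementary algebra is concentrated on algebraic series whose
coefficients span an infinite-dimensional space (such as
`∑ₙ ϖⁿ (2z₁ - 1)^{2n+1} = (2z₁ - 1)/(1 - ϖ(2z₁ - 1)²) ∈ 𝒪†_alg`, which has `∫ = 0`); such series are
NOT covered by the argument below, for them only the note's §2 (motivic) proof is available, and
nothing is claimed here.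

## Proof (elementary; not the note's)

1. For each coordinate, the Euler operator (`z_l ∂/∂z_l`, resp. `t_l ∂/∂t_l`) is a derivation of
   `𝒪`, diagonal on monomials with eigenvalue the exponent; applied coefficientwise it preserves
   `𝒪†_alg` (`mapCoeff_mem_odagger_of_leibniz`, characteristic `0`). Two distinct monomials are
   separated by one of these eigenvalues (`exists_separating_derivation`).
2. Hence (Lagrange interpolation in commuting diagonal operators, by induction on the finite set of
   monomials to kill) for `μ ∈ S` there is a `k`-linear `T_μ : 𝒪 → 𝒪`, a polynomial in these
   derivations, with `T_μ(z^a t^b) = [ (a,b) = μ ] · z^a t^b` on the monomials of `S` and such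
   that `T_μ` applied coefficientwise preserves `𝒪†_alg` (`exists_extraction`).
3. So `T_μ F = μ · A_μ(ϖ) ∈ 𝒪†_alg`, whence `A_μ(ϖ) ∈ 𝒪†_alg` (`IsAlgebraic.of_mul`: `μ` is
   algebraic and a non-zero-divisor).
4. `g ↦ g · A_μ(ϖ)` is a `k`-linear map `𝒪 → 𝒪†_alg` commuting with every coefficientwise
   `k`-linear operator, so it maps the polynomial-level relations into `span gens`; by the
   polynomial level of Théorème 1.7 (`sub_intO_smul_mono_zero_mem`: `g ≡ (∫g) · 1`), 
   `μ · A_μ - (∫μ) · A_μ ∈ span gens` (`map_sub_intO_smul_map_one_mem_span`).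
5. Summing over `μ ∈ S`: `F - ∑_μ (∫μ) A_μ ∈ span gens`, and `∑_μ (∫μ) A_μ = ∫ F = 0`.

## References

* J. Ayoub, *La version relative de la conjecture des périodes de Kontsevich–Zagier revisitée*,
  Tohoku Math. J. (2) 71 (2019), no. 3, 465–485 (doi:10.2748/tmj/1568772181; author's preprint
  `rel-KZ-bis.pdf`), §1.2: Lemmes 1.4–1.5, Notation 1.6, Théorème 1.7. (`AyoubRelKZRevisited`)
* J. Ayoub, *Une version relative de la conjecture des périodes de Kontsevich–Zagier*, Ann. of
  Math. (2) 181 (2015) 905–992.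
-/

noncomputable section

open Polynomial

namespace Literature.NumberTheory.Transcendental.AyoubRel

variable {k : Type} [Field k]

/-! ### 1. Two more functoriality lemmas for coefficientwise maps -/

section mapCoeff

variable {V W : Type} [AddCommGroup V] [Module k V] [AddCommGroup W] [Module k W]

/-- The identity applied coefficientwise is the identity. [folklore] -/
theorem mapCoeff_id (F : LaurentSeries V) : mapCoeff k (LinearMap.id : V →ₗ[k] V) F = F := by
  ext n; rfl

/-- `(c • f)_* = c • f_*` coefficientwise. [folklore] -/
theorem mapCoeff_smul_map (c : k) (f : V →ₗ[k] W) (F : LaurentSeries V) :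
    mapCoeff k (c • f) F = c • mapCoeff k f F := by
  ext n; rfl

end mapCoeff

/-! ### 2. Coordinate Euler derivations and separation of monomials -/

/-- `z_l ∂/∂z_l` is diagonal on monomials: `z_l ∂(z^a t^b)/∂z_l = a_l · z^a t^b`. [folklore] -/
theorem zEuler_mono (l : ℕ) (m : Mono) :
    (LinearMap.mulLeft k (mono k (Finsupp.single l 1, 0)) ∘ₗ dz k l) (mono k m) =
      (m.1 l : k) • mono k m := by
  obtain ⟨a, b⟩ := m
  rw [LinearMap.comp_apply, dz_mono, LinearMap.mulLeft_apply, mul_smul_comm, mono_mul_mono,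
    Prod.mk_add_mk, zero_add]
  rcases Nat.eq_zero_or_pos (a l) with h | h
  · simp only [h, Nat.cast_zero, zero_smul]
  · rw [add_tsub_cancel_of_le (Finsupp.single_le_iff.mpr h)]

/-- `z_l ∂/∂z_l` is a derivation of `𝒪`. [folklore] -/
theorem zEuler_mul (l : ℕ) (f g : O k) :
    (LinearMap.mulLeft k (mono k (Finsupp.single l 1, 0)) ∘ₗ dz k l) (f * g) =
      (LinearMap.mulLeft k (mono k (Finsupp.single l 1, 0)) ∘ₗ dz k l) f * g +
        f * (LinearMap.mulLeft k (mono k (Finsupp.single l 1, 0)) ∘ₗ dz k l) g := by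
  simp only [LinearMap.comp_apply, LinearMap.mulLeft_apply, dz_mul, mul_add]
  ring

/-- **Two distinct monomials are separated by a coordinate Euler derivation**: if `μ ≠ ν` there is
a derivation `D` of `𝒪` (`z_l ∂/∂z_l` or `t_l ∂/∂t_l` for a coordinate where the exponents differ),
diagonal on ALL monomials, whose eigenvalues at `μ` and `ν` differ (characteristic `0`).
[folklore] -/
theorem exists_separating_derivation [CharZero k] {μ ν : Mono} (h : μ ≠ ν) :
    ∃ (D : O k →ₗ[k] O k) (e : Mono → k), (∀ f g : O k, D (f * g) = D f * g + f * D g) ∧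
      (∀ m : Mono, D (mono k m) = e m • mono k m) ∧ e μ ≠ e ν := by
  by_cases h1 : μ.1 = ν.1
  · have h2 : μ.2 ≠ ν.2 := fun h2 => h (Prod.ext h1 h2)
    obtain ⟨l, hl⟩ : ∃ l, μ.2 l ≠ ν.2 l := by
      by_contra hall
      push Not at hall
      exact h2 (Finsupp.ext hall)
    exact ⟨euler k l, fun m => (m.2 l : k), euler_mul l, euler_mono l,
      fun he => hl (Int.cast_injective he)⟩
  · obtain ⟨l, hl⟩ : ∃ l, μ.1 l ≠ ν.1 l := by
      by_contra hall
      push Not at hall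
      exact h1 (Finsupp.ext hall)
    exact ⟨LinearMap.mulLeft k (mono k (Finsupp.single l 1, 0)) ∘ₗ dz k l, fun m => (m.1 l : k),
      zEuler_mul l, zEuler_mono l, fun he => hl (Nat.cast_injective he)⟩

/-! ### 3. Extraction of one monomial by a polynomial in derivations -/

/-- **Extraction operators.** For a monomial `μ` and a finite set `S` of other monomials there is
a `k`-linear `T : 𝒪 → 𝒪` — a product of factors `(D - e_ν)/(e_μ - e_ν)` in coordinate Euler
derivations — which is diagonal on all monomials, fixes `μ`, kills every monomial of `S`, and,
applied coefficientwise, PRESERVES `𝒪†_alg` (derivations do, `mapCoeff_mem_odagger_of_leibniz`).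
[folklore] -/
theorem exists_extraction [CharZero k] (μ : Mono) (S : Finset Mono) (hμ : μ ∉ S) :
    ∃ T : O k →ₗ[k] O k,
      (∀ F ∈ Odagger k, mapCoeff k T F ∈ Odagger k) ∧
      (∀ m : Mono, ∃ c : k, T (mono k m) = c • mono k m) ∧
      T (mono k μ) = mono k μ ∧ ∀ ν ∈ S, T (mono k ν) = 0 := by
  classical
  induction S using Finset.induction_on with
  | empty =>
    exact ⟨LinearMap.id, fun F hF => by rwa [mapCoeff_id], fun m => ⟨1, by simp⟩, rfl,
      fun ν hν => absurd hν (Finset.notMem_empty ν)⟩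
  | insert ν S hνS ih =>
    obtain ⟨T, hT, hdiag, hTμ, hTS⟩ := ih fun h => hμ (Finset.mem_insert_of_mem h)
    have hne : μ ≠ ν := fun h => hμ (h ▸ Finset.mem_insert_self ν S)
    obtain ⟨D, e, hD, hDe, heμν⟩ := exists_separating_derivation (k := k) hne
    have hsub : e μ - e ν ≠ 0 := sub_ne_zero.mpr heμν
    refine ⟨(e μ - e ν)⁻¹ • ((D - e ν • LinearMap.id) ∘ₗ T), ?_, ?_, ?_, ?_⟩
    · intro F hF
      rw [mapCoeff_smul_map, mapCoeff_comp_apply, mapCoeff_sub_map, mapCoeff_smul_map, mapCoeff_id]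
      exact smul_mem_odagger _ (sub_mem_odagger (mapCoeff_mem_odagger_of_leibniz D hD (hT F hF))
        (smul_mem_odagger _ (hT F hF)))
    · intro m
      obtain ⟨c, hc⟩ := hdiag m
      refine ⟨(e μ - e ν)⁻¹ * (c * (e m - e ν)), ?_⟩
      simp only [LinearMap.smul_apply, LinearMap.comp_apply, LinearMap.sub_apply, LinearMap.id_apply,
        hc, map_smul, hDe, smul_smul, ← sub_smul]
    · simp only [LinearMap.smul_apply, LinearMap.comp_apply, LinearMap.sub_apply, LinearMap.id_apply,
        hTμ, hDe, ← sub_smul, smul_smul, inv_mul_cancel₀ hsub, one_smul]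
    · intro ν' hν'
      rcases Finset.mem_insert.mp hν' with rfl | hν'S
      · obtain ⟨c, hc⟩ := hdiag ν'
        simp only [LinearMap.smul_apply, LinearMap.comp_apply, LinearMap.sub_apply,
          LinearMap.id_apply, hc, map_smul, hDe, sub_self, smul_zero]
      · simp only [LinearMap.smul_apply, LinearMap.comp_apply, hTS ν' hν'S, map_zero, smul_zero]

/-- An element of `𝒪` supported on the finite set of monomials `S` is the sum of its terms.
[folklore] -/
theorem eq_sum_smul_mono_of_mem_supported (S : Finset Mono) {f : O k}
    (hf : f ∈ AddMonoidAlgebra.supported k k (S : Set Mono)) :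
    f = ∑ ν ∈ S, f.coeff ν • mono k ν := by
  have hs : f.coeff.support ⊆ S := Finset.coe_subset.mp (AddMonoidAlgebra.mem_supported.mp hf)
  calc f = f.coeff.sum AddMonoidAlgebra.single := (AddMonoidAlgebra.sum_coeff_single f).symm
    _ = ∑ ν ∈ S, AddMonoidAlgebra.single ν (f.coeff ν) :=
        Finsupp.sum_of_support_subset _ hs _ fun ν _ => AddMonoidAlgebra.single_zero ν
    _ = ∑ ν ∈ S, f.coeff ν • mono k ν := Finset.sum_congr rfl fun ν _ => single_eq_smul_mono ν _

/-- `∫ f = ∑_{ν ∈ S} f_ν ∫ν` for `f` supported on `S`. [Ayoub, revisited note, Lemme 1.5] [folklore] -/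
theorem intO_eq_sum_of_mem_supported (S : Finset Mono) {f : O k}
    (hf : f ∈ AddMonoidAlgebra.supported k k (S : Set Mono)) :
    intO k f = ∑ ν ∈ S, f.coeff ν * monoWeight k ν := by
  conv_lhs => rw [eq_sum_smul_mono_of_mem_supported S hf]
  simp only [map_sum, map_smul, intO_mono, smul_eq_mul]

/-- An extraction operator for `μ ∈ S` picks out the `μ`-term of every `f` supported on `S`.
[folklore] -/
theorem extraction_apply {T : O k →ₗ[k] O k} {μ : Mono} {S : Finset Mono} (hμ : μ ∈ S)
    (hTμ : T (mono k μ) = mono k μ) (hTS : ∀ ν ∈ S, ν ≠ μ → T (mono k ν) = 0) {f : O k}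
    (hf : f ∈ AddMonoidAlgebra.supported k k (S : Set Mono)) :
    T f = f.coeff μ • mono k μ := by
  conv_lhs => rw [eq_sum_smul_mono_of_mem_supported S hf]
  rw [map_sum, Finset.sum_eq_single μ (fun ν hν hne => by rw [map_smul, hTS ν hν hne, smul_zero])
    (fun h => absurd hμ h), map_smul, hTμ]

/-! ### 4. Coordinate series `A(ϖ) · 1` and the maps `g ↦ g · A(ϖ)` -/

/-- Coefficients of `g · A(ϖ)`, where `A(ϖ) · 1 := (ℓ applied coefficientwise to F) · 1` for a
`k`-linear functional `ℓ` on `𝒪`. [folklore] -/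
theorem coeff_smul_mapCoeff_algebraMap (ℓ : O k →ₗ[k] k) (F : LaurentSeries (O k)) (g : O k)
    (n : ℤ) :
    (g • mapCoeff k (Algebra.linearMap k (O k) ∘ₗ ℓ) F).coeff n = ℓ (F.coeff n) • g := by
  rw [HahnSeries.coeff_smul, mapCoeff_coeff, LinearMap.comp_apply, Algebra.linearMap_apply,
    smul_eq_mul, mul_comm, ← Algebra.smul_def]

/-- **`g ↦ g · A(ϖ)` commutes with every coefficientwise `k`-linear operator** (the coefficients
of `A(ϖ) · 1` are scalars). [folklore] -/
theorem mapCoeff_smul_mapCoeff_algebraMap (L : O k →ₗ[k] O k) (ℓ : O k →ₗ[k] k)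
    (F : LaurentSeries (O k)) (g : O k) :
    mapCoeff k L (g • mapCoeff k (Algebra.linearMap k (O k) ∘ₗ ℓ) F) =
      L g • mapCoeff k (Algebra.linearMap k (O k) ∘ₗ ℓ) F := by
  ext n
  rw [mapCoeff_coeff, coeff_smul_mapCoeff_algebraMap, map_smul, coeff_smul_mapCoeff_algebraMap]

/-- `𝒪†_alg` is an `𝒪`-submodule of `𝒪((ϖ))`: `g · X ∈ 𝒪†_alg` for `X ∈ 𝒪†_alg`, `g ∈ 𝒪`.
[folklore] -/
theorem smul_mem_odagger' (g : O k) {X : LaurentSeries (O k)} (hX : X ∈ Odagger k) :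
    g • X ∈ Odagger k := by
  rw [← HahnSeries.C_mul_eq_smul]
  exact mul_mem_odagger (hahnC_mem_odagger g) hX

/-- **Division by a monomial preserves algebraicity**: if `z^a t^b · X ∈ 𝒪†_alg` then
`X ∈ 𝒪†_alg` (a monomial is algebraic and a non-zero-divisor of the domain `𝒪((ϖ))`). [folklore] -/
theorem mem_odagger_of_mono_smul_mem (m : Mono) {X : LaurentSeries (O k)}
    (h : mono k m • X ∈ Odagger k) : X ∈ Odagger k := by
  rw [← HahnSeries.C_mul_eq_smul, mem_odagger_iff] at h
  rw [mem_odagger_iff]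
  refine IsAlgebraic.of_mul ?_ ((mem_odagger_iff _).mp (hahnC_mem_odagger (mono k m))) h
  exact mem_nonZeroDivisors_of_ne_zero
    (HahnSeries.C_ne_zero (AddMonoidAlgebra.single_ne_zero.mpr one_ne_zero))

/-! ### 5. Intertwining maps send the polynomial-level relations into `span gens` -/

/-- **Transport of the polynomial level.** Let `Φ : 𝒪 → 𝒪((ϖ))` be `k`-linear with values in
`𝒪†_alg` and commuting with the operators `∂/∂zᵢ - |_{zᵢ=1} + |_{zᵢ=0}` and `tⱼ ∂/∂tⱼ`
(coefficientwise on the target). Then `Φ(f) - (∫f) · Φ(1) ∈ span_k gens` for every `f ∈ 𝒪`: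
`Φ` maps the relations of `𝒪` to generators, and `f ≡ (∫ f) · 1` modulo relations
(`sub_intO_smul_mono_zero_mem`). (`single_mem_span_ayoubGenerators` of `AyoubRelativeProofs.lean`
is the case `Φ = (· ϖⁿ)`.) [Ayoub, revisited note, Théorème 1.7 (polynomial level)] [folklore] -/
theorem map_sub_intO_smul_map_one_mem_span [CharZero k] (Φ : O k →ₗ[k] LaurentSeries (O k))
    (hO : ∀ g : O k, Φ g ∈ Odagger k)
    (hA : ∀ (i : ℕ) (g : O k), Φ (relA k i g) = mapCoeff k (relA k i) (Φ g))
    (hB : ∀ (j : ℕ) (g : O k), Φ (euler k j g) = mapCoeff k (euler k j) (Φ g)) (f : O k) :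
    Φ f - intO k f • Φ 1 ∈ Submodule.span k (ayoubGenerators k) := by
  have hA' : ∀ (i : ℕ) (g : O k), relA k i g ∈ (Submodule.span k (ayoubGenerators k)).comap Φ :=
    fun i g => Submodule.mem_comap.mpr (by
      rw [hA]
      exact Submodule.subset_span (Or.inl ⟨Φ g, hO g, i, rfl⟩))
  have hB' : ∀ (j : ℕ) (g : O k), euler k j g ∈ (Submodule.span k (ayoubGenerators k)).comap Φ :=
    fun j g => Submodule.mem_comap.mpr (by
      rw [hB]
      exact Submodule.subset_span (Or.inr ⟨Φ g, hO g, j, rfl⟩))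
  have h := sub_intO_smul_mono_zero_mem hA' hB' f
  rwa [Submodule.mem_comap, map_sub, map_smul, mono_zero] at h

/-! ### 6. Théorème 1.7 `⇒` for series involving finitely many monomials -/

/-- **Ayoub, revisited note, Théorème 1.7, direction `⇒`, for algebraic series involving only
finitely many monomials — proved.** Let `k` have characteristic `0`, `S` a finite set of monomials
`z^a t^b`, and `F ∈ 𝒪†_alg` such that every `ϖ`-coefficient of `F` is supported on `S` (i.e.
`F = ∑_{μ ∈ S} A_μ(ϖ) μ`, `A_μ ∈ k((ϖ))`). If `∫ F = 0` then `F ∈ span_k gens`.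
[Ayoub, revisited note, Théorème 1.7 (⇒, finite-rank case)] [cite: AyoubRelKZRevisited, Théorème 1.7] -/
theorem mem_span_ayoubGenerators_of_mem_supported [CharZero k] (S : Finset Mono)
    {F : LaurentSeries (O k)} (hF : F ∈ Odagger k)
    (hS : ∀ n : ℤ, F.coeff n ∈ AddMonoidAlgebra.supported k k (S : Set Mono))
    (h0 : intLaurent k F = 0) : F ∈ Submodule.span k (ayoubGenerators k) := by
  classical
  -- the coordinate series `A_μ(ϖ) · 1`
  let ℓ : Mono → (O k →ₗ[k] k) := fun μ =>
    Finsupp.lapply μ ∘ₗ (AddMonoidAlgebra.coeffLinearEquiv k).toLinearMap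
  have hℓ : ∀ (μ : Mono) (f : O k), ℓ μ f = f.coeff μ := fun μ f => rfl
  let X : Mono → LaurentSeries (O k) := fun μ => mapCoeff k (Algebra.linearMap k (O k) ∘ₗ ℓ μ) F
  -- (i) `A_μ(ϖ) · 1 ∈ 𝒪†_alg` for `μ ∈ S`, by extraction and division by `μ`
  have hXalg : ∀ μ ∈ S, X μ ∈ Odagger k := by
    intro μ hμ
    obtain ⟨T, hT, -, hTμ, hTS⟩ := exists_extraction (k := k) μ (S.erase μ) (Finset.notMem_erase μ S)
    have hTF : mapCoeff k T F = mono k μ • X μ := by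
      refine HahnSeries.ext (funext fun n => ?_)
      rw [mapCoeff_coeff, extraction_apply hμ hTμ
        (fun ν hν hne => hTS ν (Finset.mem_erase.mpr ⟨hne, hν⟩)) (hS n),
        coeff_smul_mapCoeff_algebraMap, hℓ]
    exact mem_odagger_of_mono_smul_mem μ (hTF ▸ hT F hF)
  -- (ii) `μ · A_μ - (∫μ) · A_μ ∈ span gens`
  have hgen : ∀ μ ∈ S, mono k μ • X μ - monoWeight k μ • X μ ∈
      Submodule.span k (ayoubGenerators k) := by
    intro μ hμ
    have h := map_sub_intO_smul_map_one_mem_span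
      ((LinearMap.toSpanSingleton (O k) (LaurentSeries (O k)) (X μ)).restrictScalars k)
      (fun g => smul_mem_odagger' g (hXalg μ hμ))
      (fun i g => (mapCoeff_smul_mapCoeff_algebraMap (relA k i) (ℓ μ) F g).symm)
      (fun j g => (mapCoeff_smul_mapCoeff_algebraMap (euler k j) (ℓ μ) F g).symm) (mono k μ)
    simpa only [LinearMap.restrictScalars_apply, LinearMap.toSpanSingleton_apply, intO_mono,
      one_smul] using h
  -- (iii) `F = ∑_μ μ · A_μ`
  have hFsum : F = ∑ μ ∈ S, mono k μ • X μ := by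
    refine HahnSeries.ext (funext fun n => ?_)
    rw [HahnSeries.coeff_sum]
    simp only [X, coeff_smul_mapCoeff_algebraMap, hℓ]
    exact eq_sum_smul_mono_of_mem_supported S (hS n)
  -- (iv) `∑_μ (∫μ) · A_μ = ∫ F = 0`
  have hwsum : ∑ μ ∈ S, monoWeight k μ • X μ = 0 := by
    refine HahnSeries.ext (funext fun n => ?_)
    rw [HahnSeries.coeff_sum, HahnSeries.coeff_zero]
    simp only [X, HahnSeries.coeff_smul, mapCoeff_coeff, LinearMap.comp_apply,
      Algebra.linearMap_apply, hℓ, Algebra.smul_def, ← map_mul, ← map_sum]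
    have hint : ∑ x ∈ S, monoWeight k x * (F.coeff n).coeff x = 0 := by
      rw [← intO_coeff_eq_zero_of_intLaurent_eq_zero F h0 n, intO_eq_sum_of_mem_supported S (hS n)]
      exact Finset.sum_congr rfl fun x _ => mul_comm _ _
    rw [hint, map_zero]
  -- (v) conclusion
  have hF' : F = ∑ μ ∈ S, (mono k μ • X μ - monoWeight k μ • X μ) +
      ∑ μ ∈ S, monoWeight k μ • X μ := by
    rw [Finset.sum_sub_distrib, sub_add_cancel, ← hFsum]
  rw [hF', hwsum, add_zero]
  exact Submodule.sum_mem _ hgen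

/-- The same, with the hypothesis phrased intrinsically: the `ϖ`-coefficients of `F` lie in a
FINITE-DIMENSIONAL `k`-subspace of `𝒪`. [Ayoub, revisited note, Théorème 1.7 (⇒, finite-rank
case)] [cite: AyoubRelKZRevisited, Théorème 1.7] -/
theorem mem_span_ayoubGenerators_of_finiteDimensional [CharZero k] {F : LaurentSeries (O k)}
    (hF : F ∈ Odagger k) (V : Submodule k (O k)) [FiniteDimensional k V]
    (hV : ∀ n : ℤ, F.coeff n ∈ V) (h0 : intLaurent k F = 0) :
    F ∈ Submodule.span k (ayoubGenerators k) := by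
  classical
  obtain ⟨t, ht⟩ : V.FG := Module.Finite.iff_fg.mp ‹_›
  refine mem_span_ayoubGenerators_of_mem_supported (t.biUnion fun v => v.coeff.support) hF
    (fun n => ?_) h0
  have hle : V ≤ AddMonoidAlgebra.supported k k ((t.biUnion fun v => v.coeff.support : Finset Mono) :
      Set Mono) := by
    rw [← ht, Submodule.span_le]
    intro v hv
    rw [SetLike.mem_coe, AddMonoidAlgebra.mem_supported, Finset.coe_subset]
    exact Finset.subset_biUnion_of_mem (fun v : O k => v.coeff.support) hv
  exact hle (hV n)

/-- The finite-support case of `AyoubRelativeProofs.lean` is an instance: a `ϖ`-Laurent polynomial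
involves only finitely many monomials. [folklore] -/
theorem exists_supported_of_finite_support (F : LaurentSeries (O k)) (hF : F.support.Finite) :
    ∃ S : Finset Mono, ∀ n : ℤ, F.coeff n ∈ AddMonoidAlgebra.supported k k (S : Set Mono) := by
  classical
  refine ⟨hF.toFinset.biUnion fun n => (F.coeff n).coeff.support, fun n => ?_⟩
  rw [AddMonoidAlgebra.mem_supported']
  intro m hm
  by_contra h
  refine hm (Finset.mem_coe.mpr (Finset.mem_biUnion.mpr ⟨n, ?_, Finsupp.mem_support_iff.mpr h⟩))
  rw [Set.Finite.mem_toFinset, HahnSeries.mem_support]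
  intro h0
  rw [h0] at h
  exact h rfl

/-- **Ayoub, revisited note, Théorème 1.7 — the finite-rank case, proved, in the shape of the named
fact `ayoub_relativeKZ_revisited`** (whose general `→` is motivic and stays a named fact): for every
field `k` of characteristic `0` (no embedding into `ℂ` needed) and every `F ∈ 𝒪†_alg` involving only
finitely many monomials `z^a t^b`, `∫ F = 0 ↔ F ∈ span_k gens`.
[Ayoub, revisited note, Théorème 1.7 (finite-rank case)] [cite: AyoubRelKZRevisited, Théorème 1.7] -/
theorem ayoub_relativeKZ_revisited_finiteRank :
    ∀ (k : Type) [Field k] [CharZero k], ∀ F ∈ Odagger k,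
      (∃ S : Finset Mono, ∀ n : ℤ, F.coeff n ∈ AddMonoidAlgebra.supported k k (S : Set Mono)) →
      (intLaurent k F = 0 ↔ F ∈ Submodule.span k (ayoubGenerators k)) :=
  fun k _ _ F hF ⟨S, hS⟩ =>
    ⟨mem_span_ayoubGenerators_of_mem_supported S hF hS, ayoub_relativeKZ_revisited_easy k F⟩

end Literature.NumberTheory.Transcendental.AyoubRel
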